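import Summits.ABC.ABC.Theses.BelyiSqueeze
import Literature.NumberTheory.DiophantineGeometry.BelyiPolynomialWitness

/-!
# `BelyiSqueeze.DegBelyiRadical` is abc-implied; `BelyiWitnessLeC` and the `Assembly` hold

Proof-only file over the CLOSED route ABC/BelyiSqueeze (`Summits/ABC/ABC/Theses/BelyiSqueeze.lean`;
closed·refuted 2026-08-15 through its crux `DegBelyiLower`, `BelyiSqueezeDegBelyiLower_refuted`). It decides
what the kernel can say about the route's OTHER crux, item stmt-ABC-1206 `DegBelyiRadical`
("conductor-effective Belyi": `∀ ε > 0 ∃ C_ε ∀ abc triples, deg_B(a/c) ≤ C_ε·rad(abc)^{1+ε}`, inlined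
cross-ratio normal form), which the abc-iut cell's FROZEN FACT-LIST carries as row F-2686 under the
erroneous locator «[GenEll] Thm 3.2»:

* `belyiWitnessLeC_holds` — support item stmt-ABC-1208 `BelyiWitnessLeC` («deg_B(a/c) ≤ c», Belyĭ 1980;
  «provable now», never landed): Belyi's polynomial `c^c x^a (1−x)^b/(a^a b^b)` in the route's normal form
  (`Literature…IsABCTriple.exists_crossRatio_witness`, `BelyiPolynomialWitness.lean`);
* `degBelyiRadical_of_abc` — **`ABC → DegBelyiRadical`** (take `n := c < C_ε·rad^{1+ε}` and Belyi's
  polynomial): the crux is a NECESSARY CONDITION for abc ("Implied by ABC (deg_B(a/c) ≤ c, Belyi1980;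
  BG2006 Conj.12.2.2)", route docstring);
* `assembly_holds` — assembly item stmt-ABC-1207 `Assembly : DegBelyiLower → DegBelyiRadical → ABC`, the
  squeeze `c ≤ C₁·n^{1+ε'} ≤ C₁·(C₂·rad^{1+ε'})^{1+ε'} ≤ C₁·C₂^{1+ε'}·rad^{1+ε}` with `ε' = min(ε,1)/3`
  (`(1+ε')² ≤ 1+ε`, `rad ≥ 1`), proved honestly by `Real.rpow` bookkeeping (NOT via the refutation of its
  antecedent);
* `degBelyiRadical_iff_abc_of_degBelyiLower` — hence `DegBelyiLower → (DegBelyiRadical ↔ ABC)`.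

Reading for the FACT-LIST: `DegBelyiRadical` is an abc-implied, unproved CONJECTURE (equivalent to abc
granted the refuted anti-Belyi crux; no construction of dessins of size `rad^{1+ε}` is known) — NOT a
published theorem, hence not a dischargeable fact. Nothing here asserts abc proved or refuted.
Cell abc-iut, seat abc-iut-f-135 (gen 6), F-2686.
-/

set_option linter.dupNamespace false

namespace Summit.ABC.ABC.Theorems

open Literature.NumberTheory.DiophantineGeometry
open Summit.ABC.ABC.Theses.BelyiSqueeze

/-- **`BelyiWitnessLeC` holds** (route ABC/BelyiSqueeze, support item stmt-ABC-1208; Belyĭ 1980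
«deg_B(a/c) ≤ c»): for every abc triple Belyi's polynomial `β_{a,b} = c^c x^a(1−x)^b/(a^a b^b)` is a
degree-`c` Belyi map with `{0, 1, ∞, a/c}` special, presented in the route's cross-ratio normal form by
`IsABCTriple.exists_crossRatio_witness`. [cite: Belyi1980, §3] -/
theorem belyiWitnessLeC_holds : Summit.ABC.ABC.Theses.BelyiSqueeze.BelyiWitnessLeC := by
  intro a b c h
  exact ⟨c, le_rfl, h.exists_crossRatio_witness⟩

/-- **abc implies `DegBelyiRadical`** (crux 3 of route ABC/BelyiSqueeze is a necessary condition for abc):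
given `ε > 0` and the abc constant `C_ε`, every abc triple has the Belyi-polynomial witness of degree
`n := c < C_ε·rad(abc)^{1+ε}`. [cite: Belyi1980, §3] -/
theorem degBelyiRadical_of_abc (hABC : _root_.ABC) : Summit.ABC.ABC.Theses.BelyiSqueeze.DegBelyiRadical := by
  intro ε hε
  obtain ⟨C, hC, hbound⟩ := hABC ε hε
  refine ⟨C, hC, fun a b c h => ⟨c, (hbound a b c h).le, h.exists_crossRatio_witness⟩⟩

/-- Exponent bookkeeping for the squeeze: with `ε' = min ε 1 / 3` one has `0 < ε'` and
`(1 + ε') * (1 + ε') ≤ 1 + ε`. [folklore] -/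
private theorem squeeze_exponent {ε : ℝ} (hε : 0 < ε) :
    0 < min ε 1 / 3 ∧ (1 + min ε 1 / 3) * (1 + min ε 1 / 3) ≤ 1 + ε := by
  have hm0 : 0 < min ε 1 := lt_min hε one_pos
  have hmε : min ε 1 ≤ ε := min_le_left _ _
  have hm1 : min ε 1 ≤ 1 := min_le_right _ _
  refine ⟨by positivity, ?_⟩
  nlinarith [hm0, hmε, hm1]

/-- **The squeeze `Assembly : DegBelyiLower → DegBelyiRadical → ABC` holds** (assembly item stmt-ABC-1207 of
route ABC/BelyiSqueeze): given `ε > 0` put `ε' = min(ε,1)/3`, take `C₁` (anti-Belyi crux at `ε'`) and `C₂`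
(conductor-effective crux at `ε'`); for a triple the second gives a witness of degree `n ≤ C₂·rad^{1+ε'}`,
the first gives `c ≤ C₁·n^{1+ε'} ≤ C₁·C₂^{1+ε'}·rad^{(1+ε')²} ≤ C₁·C₂^{1+ε'}·rad^{1+ε}` (`rad ≥ 1`,
`(1+ε')² ≤ 1+ε`), so `c < (C₁·C₂^{1+ε'} + 1)·rad^{1+ε}` — Bombieri–Gubler Conj. 12.2.2. Proved by real-exponent
bookkeeping, independently of the refutation of the antecedent `DegBelyiLower`.
[cite: BombieriGubler2006, Conj. 12.2.2] -/
theorem assembly_holds : Summit.ABC.ABC.Theses.BelyiSqueeze.Assembly := by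
  intro hLower hRadical ε hε
  obtain ⟨hε', hsq⟩ := squeeze_exponent hε
  set ε' : ℝ := min ε 1 / 3 with hε'def
  obtain ⟨C₁, hC₁, h₁⟩ := hLower ε' hε'
  obtain ⟨C₂, hC₂, h₂⟩ := hRadical ε' hε'
  refine ⟨C₁ * C₂ ^ (1 + ε') + 1, by positivity, fun a b c h => ?_⟩
  obtain ⟨n, hn, P, Q, x, y, z, w, hw⟩ := h₂ a b c h
  have hc : (c : ℝ) ≤ C₁ * (n : ℝ) ^ (1 + ε') := h₁ a b c h n ⟨P, Q, x, y, z, w, hw⟩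
  -- the radical is a positive natural number
  set r : ℝ := ((rad a b c : ℕ) : ℝ) with hr
  have hrad0 : rad a b c ≠ 0 := by
    rw [rad_def]
    exact UniqueFactorizationMonoid.radical_ne_zero
  have hr1 : 1 ≤ r := by rw [hr]; exact_mod_cast Nat.one_le_iff_ne_zero.mpr hrad0
  have hr0 : 0 ≤ r := zero_le_one.trans hr1
  have hn0 : (0 : ℝ) ≤ n := Nat.cast_nonneg _
  have h1ε' : 0 ≤ 1 + ε' := by linarith
  -- `n^{1+ε'} ≤ (C₂ r^{1+ε'})^{1+ε'} = C₂^{1+ε'} r^{(1+ε')²} ≤ C₂^{1+ε'} r^{1+ε}`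
  have hstep1 : (n : ℝ) ^ (1 + ε') ≤ (C₂ * r ^ (1 + ε')) ^ (1 + ε') :=
    Real.rpow_le_rpow hn0 hn h1ε'
  have hstep2 : (C₂ * r ^ (1 + ε')) ^ (1 + ε') = C₂ ^ (1 + ε') * r ^ ((1 + ε') * (1 + ε')) := by
    rw [Real.mul_rpow hC₂.le (Real.rpow_nonneg hr0 _), ← Real.rpow_mul hr0]
  have hstep3 : r ^ ((1 + ε') * (1 + ε')) ≤ r ^ (1 + ε) :=
    Real.rpow_le_rpow_of_exponent_le hr1 hsq
  have hC₂' : 0 ≤ C₂ ^ (1 + ε') := Real.rpow_nonneg hC₂.le _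
  have hkey : (c : ℝ) ≤ C₁ * C₂ ^ (1 + ε') * r ^ (1 + ε) :=
    calc (c : ℝ) ≤ C₁ * (n : ℝ) ^ (1 + ε') := hc
      _ ≤ C₁ * (C₂ * r ^ (1 + ε')) ^ (1 + ε') := mul_le_mul_of_nonneg_left hstep1 hC₁.le
      _ = C₁ * (C₂ ^ (1 + ε') * r ^ ((1 + ε') * (1 + ε'))) := by rw [hstep2]
      _ ≤ C₁ * (C₂ ^ (1 + ε') * r ^ (1 + ε)) :=
          mul_le_mul_of_nonneg_left (mul_le_mul_of_nonneg_left hstep3 hC₂') hC₁.le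
      _ = C₁ * C₂ ^ (1 + ε') * r ^ (1 + ε) := by ring
  have hrpow1 : 1 ≤ r ^ (1 + ε) := Real.one_le_rpow hr1 (by linarith)
  calc (c : ℝ) ≤ C₁ * C₂ ^ (1 + ε') * r ^ (1 + ε) := hkey
    _ < C₁ * C₂ ^ (1 + ε') * r ^ (1 + ε) + r ^ (1 + ε) := by linarith
    _ = (C₁ * C₂ ^ (1 + ε') + 1) * r ^ (1 + ε) := by ring

/-- Hence, GRANTED the (refuted) anti-Belyi crux, `DegBelyiRadical` is EQUIVALENT to abc: the
conductor-effective Belyi conjecture is abc "reached through a different door" (route docstring). [folklore] -/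
theorem degBelyiRadical_iff_abc_of_degBelyiLower (hLower : Summit.ABC.ABC.Theses.BelyiSqueeze.DegBelyiLower) :
    Summit.ABC.ABC.Theses.BelyiSqueeze.DegBelyiRadical ↔ _root_.ABC :=
  ⟨fun h => assembly_holds hLower h, degBelyiRadical_of_abc⟩

end Summit.ABC.ABC.Theorems
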